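import Summits.NavierStokesRegularity.NavierStokesRegularity.Theorems.ClockStretchingLawClockCeilingZoomScaling
import Literature.Analysis.FluidPDE.AncientMildCompactness
import Literature.Analysis.FluidPDE.KNSSSmoothingHolds
import HarnessLib

/-!
# Route ClockStretchingLaw — crux `ClockCeiling`, line `registered`: zoom limits of a Type-I
# ancient mild field exist and are Type-I ancient mild fields

Helper file for the lead's stub `stub_zoomCompactness` of the reshaped skeleton of crux
`ClockCeiling` (item stmt-NavierStokesRegularity-10570). For a Type-I ancient mild field `u`
(`IsTypeIAncientMild C u`: jointly smooth on `(-∞,0) × ℝ³`, divergence-free slices, the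
KNSS-mild Oseen identity between all pairs of negative times, `‖u(t,x)‖ ≤ C/√(-t)`) and any
sequence of zoom factors `Λₙ > 0`, the zooms `nsRescale Λₙ u = (t,x) ↦ Λₙ u(Λₙ² t, Λₙ x)` are
again Type-I ancient mild fields with the same constant (`zoom_isTypeIAncientMild`), so KNSS
2009 Lemma 6.1 in its Type-I-rate form (`KNSS2009_lemma61_typeI_rate`, proved in the tree)
extracts a subsequence converging pointwise on the open slab, and locally uniformly on every
negative slice, to an Oseen-mild field `W` with the same rate; and `W` is again a Type-I ancient
mild field: jointly smooth by KNSS 2009 Prop. 4.1 (`knss2009_smoothing_holds`) applied on the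
windows `(2t, t/2)`, with divergence-free slices (smooth + weakly divergence free).

Main result: `exists_zoomLimit` (registered sub-goal `zoomLimit_exists`).

## References

* G. Koch, N. Nadirashvili, G. Seregin, V. Šverák, Acta Math. 203 (2009) = arXiv:0709.3599,
  Lemma 6.1 (p. 11), Prop. 4.1 (p. 8), proof of Thm 6.2 (p. 13).
-/

set_option linter.dupNamespace false

noncomputable section

open Literature.Analysis.FluidPDE MeasureTheory Set Function Filter Topology Metric
open Literature.Analysis.UnboundedOperators (heatExtension)
open scoped ENNReal NNReal

namespace Summit.NavierStokesRegularity.NavierStokesRegularity.Theorems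

section Limit

variable {C : ℝ} {W : ℝ → (EuclideanSpace ℝ (Fin 3)) → (EuclideanSpace ℝ (Fin 3))}

/-- **An Oseen-mild field with the Type-I rate is jointly smooth** (KNSS 2009 Prop. 4.1, the
tree's `knss2009_smoothing_holds`, on the windows `(2t, t/2)`): continuity on the open slab, the
rate `√(-t)‖W(t,x)‖ ≤ C` and the Oseen identity `W(t) = e^{(t-s)Δ}W(s) - B¹ₛ(W,W)(t)` for all
`s < t < 0` imply `uncurry W ∈ C^∞((-∞,0) × ℝ³)`. -/
theorem contDiffOn_of_oseenMild_rate (hWc : ContinuousOn (uncurry W) (Iio 0 ×ˢ univ))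
    (hWb : ∀ t < 0, ∀ x, Real.sqrt (-t) * ‖W t x‖ ≤ C)
    (hWmild : ∀ s t : ℝ, s < t → t < 0 → ∀ x,
      W t x = heatExtension (W s) (t - s) x - oseenDuhamel 1 s W W t x) :
    ContDiffOn ℝ (⊤ : ℕ∞) (uncurry W) (Iio 0 ×ˢ univ) := by
  have hC : 0 ≤ C :=
    (mul_nonneg (Real.sqrt_nonneg _) (norm_nonneg _)).trans (hWb (-1) (by norm_num) 0)
  have hrate : ∀ t < 0, ∀ x, ‖W t x‖ ≤ C / Real.sqrt (-t) := fun t ht x => by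
    rw [le_div_iff₀ (Real.sqrt_pos.2 (neg_pos.2 ht)), mul_comm]; exact hWb t ht x
  refine contDiffOn_of_locally_contDiffOn fun p hp => ?_
  obtain ⟨hp1, -⟩ := mem_prod.1 hp
  have ht : p.1 < 0 := hp1
  -- the window `(2t, t/2) ∋ t`
  set s : ℝ := 2 * p.1 with hs
  set T₁ : ℝ := p.1 / 2 with hT₁
  have hsT : s < T₁ := by rw [hs, hT₁]; linarith
  have hT₁0 : T₁ < 0 := by rw [hT₁]; linarith
  have hs0 : s < 0 := by linarith
  set M : ℝ := C / Real.sqrt (-T₁) with hM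
  have hM0 : 0 ≤ M := div_nonneg hC (Real.sqrt_nonneg _)
  have hbd : ∀ τ ≤ T₁, ∀ y, ‖W τ y‖ ≤ M := fun τ hτ y =>
    (hrate τ (hτ.trans_lt hT₁0) y).trans (div_le_div_of_nonneg_left hC
      (Real.sqrt_pos.2 (neg_pos.2 hT₁0)) (Real.sqrt_le_sqrt (by linarith)))
  have hslice : ∀ τ < 0, Continuous (W τ) := fun τ hτ =>
    hWc.comp_continuous (f := fun y => (τ, y)) (by fun_prop) fun y => mk_mem_prod hτ (mem_univ _)
  have ha : AEStronglyMeasurable (W s) volume := (hslice s hs0).aestronglyMeasurable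
  have haM : eLpNorm (W s) ∞ volume ≤ ENNReal.ofReal M := by
    rw [eLpNorm_exponent_top]
    exact eLpNormEssSup_le_of_ae_bound (Eventually.of_forall fun y => hbd s hsT.le y)
  have hum : AEStronglyMeasurable (uncurry W)
      ((volume : Measure (ℝ × (EuclideanSpace ℝ (Fin 3)))).restrict (Ioo s T₁ ×ˢ univ)) :=
    (hWc.mono (prod_mono (fun τ hτ => (hτ.2.trans hT₁0 : τ < 0)) Subset.rfl)).aestronglyMeasurable
      (measurableSet_Ioo.prod MeasurableSet.univ)
  have hsl : ∀ τ ∈ Ioo s T₁, eLpNorm (W τ) ∞ volume ≤ ENNReal.ofReal M := fun τ hτ => by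
    rw [eLpNorm_exponent_top]
    exact eLpNormEssSup_le_of_ae_bound (Eventually.of_forall fun y => hbd τ hτ.2.le y)
  have hid : ∀ τ ∈ Ioo s T₁, W τ =ᵐ[volume]
      fun x => heatExtension (W s) (1 * (τ - s)) x - oseenDuhamel 1 s W W τ x := fun τ hτ =>
    Eventually.of_forall fun x => by rw [one_mul]; exact hWmild s τ hτ.1 (hτ.2.trans hT₁0) x
  obtain ⟨hsmooth, -, -⟩ := knss2009_smoothing_holds (EuclideanSpace ℝ (Fin 3)) one_pos hsT hM0
    ha haM hum hsl hid
  -- `W` coincides with the smooth representative on the window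
  refine ⟨Ioo s T₁ ×ˢ univ, isOpen_Ioo.prod isOpen_univ,
    mk_mem_prod ⟨by rw [hs]; linarith, by rw [hT₁]; linarith⟩ (mem_univ _), ?_⟩
  have hsub : (Iio (0 : ℝ) ×ˢ (univ : Set (EuclideanSpace ℝ (Fin 3)))) ∩ Ioo s T₁ ×ˢ univ =
      Ioo s T₁ ×ˢ univ := by
    ext q
    simp only [mem_inter_iff, mem_prod, mem_Iio, mem_Ioo, mem_univ, and_true]
    constructor
    · rintro ⟨-, h⟩; exact h
    · rintro h; exact ⟨h.2.trans hT₁0, h⟩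
  rw [hsub]
  refine (hsmooth : ContDiffOn ℝ (⊤ : ℕ∞) _ _).congr fun q hq => ?_
  obtain ⟨hq1, -⟩ := mem_prod.1 hq
  show W q.1 q.2 = heatExtension (W s) (1 * (q.1 - s)) q.2 - oseenDuhamel 1 s W W q.1 q.2
  rw [one_mul]
  exact hWmild s q.1 hq1.1 (hq1.2.trans hT₁0) q.2

/-- **The limit field of KNSS Lemma 6.1 (Type-I-rate form) is a Type-I ancient mild field**:
continuity, weakly divergence-free slices, the rate and the Oseen identity upgrade to the four
clauses of `IsTypeIAncientMild C W` (smoothness: `contDiffOn_of_oseenMild_rate`; divergence: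
smooth + weakly divergence free, `IsWeaklyDivFree.isDivFree_of_contDiff`). -/
theorem isTypeIAncientMild_of_oseenMild_rate (hWc : ContinuousOn (uncurry W) (Iio 0 ×ˢ univ))
    (hWdiv : ∀ t < 0, IsWeaklyDivFree (W t))
    (hWb : ∀ t < 0, ∀ x, Real.sqrt (-t) * ‖W t x‖ ≤ C)
    (hWmild : ∀ s t : ℝ, s < t → t < 0 → ∀ x,
      W t x = heatExtension (W s) (t - s) x - oseenDuhamel 1 s W W t x) :
    IsTypeIAncientMild C W := by
  have hsm := contDiffOn_of_oseenMild_rate hWc hWb hWmild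
  have hsm' : IsSmoothSpaceTimeOn (Iio 0) W := hsm
  have hslice : ∀ t < 0, ContDiff ℝ (⊤ : ℕ∞) (W t) := fun t ht => hsm'.contDiff_slice ht
  refine ⟨hsm, fun t ht => (hWdiv t ht).isDivFree_of_contDiff ((hslice t ht).of_le (by norm_cast)),
    fun s t hst ht x => ?_, fun t ht x => ?_⟩
  · rw [heatFlow_of_pos _ (sub_pos.2 hst)]
    exact hWmild s t hst ht x
  · rw [le_div_iff₀ (Real.sqrt_pos.2 (neg_pos.2 ht)), mul_comm]
    exact hWb t ht x

end Limit

section Zoom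

variable {C : ℝ} {u : ℝ → (EuclideanSpace ℝ (Fin 3)) → (EuclideanSpace ℝ (Fin 3))} {Λ : ℕ → ℝ}

/-- **Zoom limits exist in the class (KNSS 2009 Lemma 6.1 for the zooms of one Type-I ancient
mild field).** For `Λₙ > 0` a subsequence of the zooms `nsRescale Λₙ u` converges — pointwise on
`(-∞,0) × ℝ³` and locally uniformly on every negative slice — to a Type-I ancient mild field `W`
with the same constant. -/
theorem exists_zoomLimit (hu : IsTypeIAncientMild C u) (hΛ : ∀ n, 0 < Λ n) :
    ∃ (φ : ℕ → ℕ) (W : ℝ → (EuclideanSpace ℝ (Fin 3)) → (EuclideanSpace ℝ (Fin 3))),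
      StrictMono φ ∧ IsTypeIAncientMild C W ∧
      (∀ t < 0, ∀ x, Tendsto (fun j => nsRescale (Λ (φ j)) u t x) atTop (𝓝 (W t x))) ∧
      (∀ t < 0, TendstoLocallyUniformly (fun j => nsRescale (Λ (φ j)) u t) (W t) atTop) := by
  set w : ℕ → ℝ → (EuclideanSpace ℝ (Fin 3)) → (EuclideanSpace ℝ (Fin 3)) :=
    fun n => nsRescale (Λ n) u with hw_def
  have hw : ∀ n, IsTypeIAncientMild C (w n) := fun n => zoom_isTypeIAncientMild hu (hΛ n)
  set A : ℕ → ℝ := fun k => -((k : ℝ) + 1) with hA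
  have hAlim : Tendsto A atTop atBot :=
    tendsto_neg_atTop_atBot.comp (tendsto_natCast_atTop_atTop.atTop_add tendsto_const_nhds)
  have hcont : ∀ k, ContinuousOn (uncurry (w k)) (Ioo (A k) 0 ×ˢ univ) := fun k =>
    (hw k).continuousOn_uncurry.mono (prod_mono (fun τ hτ => (hτ.2 : τ < 0)) Subset.rfl)
  have hdiv : ∀ k, ∀ t ∈ Ioo (A k) 0, IsWeaklyDivFree (w k t) := fun k t ht =>
    (hw k).isWeaklyDivFree ht.2
  have hmild : ∀ k, ∀ s t : ℝ, A k < s → s < t → t < 0 → ∀ x,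
      w k t x = heatExtension (w k s) (t - s) x - oseenDuhamel 1 s (w k) (w k) t x :=
    fun k s t _ hst ht x => (hw k).mild_eq_heatExtension hst ht x
  have hI : ∀ k, ∀ τ ∈ Ioo (A k) 0, ∀ x, Real.sqrt (-τ) * ‖w k τ x‖ ≤ C := by
    intro k τ hτ x
    have hs : 0 < Real.sqrt (-τ) := Real.sqrt_pos.2 (neg_pos.2 hτ.2)
    rw [mul_comm, ← le_div_iff₀ hs]
    exact (hw k).norm_le hτ.2 x
  obtain ⟨φ, W, hφ, hWc, hWdiv, hWb, hWmild, -, hpt, hloc⟩ :=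
    KNSS2009_lemma61_typeI_rate hAlim hcont hdiv hmild hI
  exact ⟨φ, W, hφ, isTypeIAncientMild_of_oseenMild_rate hWc hWdiv hWb hWmild, hpt, hloc⟩


/-- **Zoom limits exist in the class** (registered sub-goal `zoomLimit_exists` of
`stub_zoomCompactness`; closed form of `exists_zoomLimit`). -/
theorem zoomLimit_exists :
    ∀ (C : ℝ) (u : ℝ → EuclideanSpace ℝ (Fin 3) → EuclideanSpace ℝ (Fin 3)) (Λ : ℕ → ℝ), Literature.Analysis.FluidPDE.IsTypeIAncientMild C u → (∀ n, 0 < Λ n) → ∃ (φ : ℕ → ℕ) (W : ℝ → EuclideanSpace ℝ (Fin 3) → EuclideanSpace ℝ (Fin 3)), StrictMono φ ∧ Literature.Analysis.FluidPDE.IsTypeIAncientMild C W ∧ (∀ t : ℝ, t < 0 → ∀ x, Filter.Tendsto (fun j => Literature.Analysis.FluidPDE.nsRescale (Λ (φ j)) u t x) Filter.atTop (nhds (W t x))) ∧ (∀ t : ℝ, t < 0 → TendstoLocallyUniformly (fun j => Literature.Analysis.FluidPDE.nsRescale (Λ (φ j)) u t) (W t) Filter.atTop) :=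
  fun _ _ _ hu hΛ => exists_zoomLimit hu hΛ

end Zoom

end Summit.NavierStokesRegularity.NavierStokesRegularity.Theorems

end
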